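import Literature.Barriers.Parity.LinearSieveOptimality
import Literature.NumberTheory.LFunctions.LiouvilleSumExpSqrtBound
import HarnessLib

/-!
# `LinearSieveOptimality` — companion file: discharge of `Greaves2001_selbergSet_remainder`

Topic `Literature/Barriers/Parity`, companion of the catalogue entry `LinearSieveOptimality.lean`
(Selberg's extremal examples for the linear sieve, Greaves 2001 §4.5.1), kept separate so that the
statement file and its light import graph are unchanged. Everything here is PROVED; no new
definitions, no named facts.

* `Greaves2001_selbergSet_remainder_holds : Greaves2001_selbergSet_remainder` — Greaves (4.5.1.3):
  Selberg's sets `𝒜^{(−)^r}(X) = {2X ≤ a < 4X : Ω(a) ≡ r + 1 (mod 2)}` have Selberg-type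
  remainders, `|𝒜_d(X) − X/d| ≤ K (X/d) e^{−c√log(X/d)}` for all `r`, `X ≥ 1`, `d ≥ 1`.
  Proof as printed (p. 123): the multiples of `d` in `𝒜^{(−)^r}(X)` are the `dm` with
  `2X/d ≤ m < 4X/d` and `Ω(m) ≡ r + 1 + Ω(d) (mod 2)` (`Ω` is totally additive), so
  `|𝒜_d| = ∑_{2Y ≤ m < 4Y} ½(1 ± λ(m))` with `Y = X/d`, `= Y + O(1) ± ½(L(⌈4Y⌉ − 1) − L(⌈2Y⌉ − 1))`,
  `L(n) = ∑_{m ≤ n} λ(m)`, and the prime number theorem for `λ` with de la Vallée-Poussin's error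
  term, `|L(x)| ≤ C x e^{−c√log x}` (Greaves (4.5.1.2); tree:
  `Literature.NumberTheory.LFunctions.abs_sum_liouville_le_mul_exp_neg_sqrt_log`, PROVED), bounds
  both `L`-values by `C' Y e^{−c√log Y}` (they sit at arguments in `[Y, 4Y]`); the `O(1)` is
  absorbed using `Y e^{−c√log Y} ≥ e^{−c²/4}` for `Y ≥ 1`. For `Y < 1` (i.e. `d > X`, outside the
  printed range of sifting moduli) the bound reads `K·Y` and holds with `K = 7` by counting
  (`𝒜_d = ∅` for `Y ≤ 1/4`, `|𝒜_d| ≤ 2Y + 1 ≤ 6Y` otherwise), as announced in the docstring of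
  `IsSelbergRegular`.
* with it, the unconditional sifting-limit half of the barrier:
  `siftingLimit_two_optimal : … ∀ φ, IsLinearLowerSieveFun c K φ → ∀ s ∈ [1, 2), φ s ≤ 0`
  (`siftingLimit_two_optimal_of_remainder` fed with the discharged fact).

## References

* G. Greaves, *Sieves in Number Theory*, Springer (2001), §4.5.1 (1.1)–(1.3), p. 123
  [Greaves2001] (held: `lit read book:greavesnd-sieves-number-theory`, PDF p. 123).
-/

noncomputable section

open Filter Finset ArithmeticFunction
open scoped ArithmeticFunction.Omega

namespace Literature.Barriers.Parity

/-! ### Counting the multiples of `d` in Selberg's sets -/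

/-- `m ∈ [⌈2Y⌉, ⌈4Y⌉) ↔ 2Y ≤ m < 4Y`. [folklore] -/
theorem mem_Ico_ceil_iff {Y : ℝ} {m : ℕ} :
    m ∈ Ico ⌈2 * Y⌉₊ ⌈4 * Y⌉₊ ↔ 2 * Y ≤ (m : ℝ) ∧ (m : ℝ) < 4 * Y := by
  rw [mem_Ico, Nat.ceil_le, Nat.lt_ceil]

/-- The multiples of `d ≥ 1` in `𝒜^{(−)^r}(X)` are the `d·m` with `2X/d ≤ m < 4X/d` and
`Ω(dm) ≡ r + 1 (mod 2)` ("`a = dn`, `Ω(n) ≡ r + 1 + Ω(d)`, `2X ≤ a < 4X`").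
[cite: Greaves2001, §4.5.1 p. 123] -/
theorem filter_dvd_selbergSet_eq_image {d : ℕ} (hd : 0 < d) (r : ℕ) (X : ℝ) :
    (selbergSet r X).filter (d ∣ ·) =
      ((Ico ⌈2 * (X / d)⌉₊ ⌈4 * (X / d)⌉₊).filter fun m => Ω (d * m) % 2 = (r + 1) % 2).image
        (d * ·) := by
  have hd' : (0 : ℝ) < d := by exact_mod_cast hd
  ext a
  simp only [mem_filter, mem_image, mem_selbergSet, mem_Ico_ceil_iff]
  constructor
  · rintro ⟨⟨⟨h2, h4⟩, hpar⟩, m, rfl⟩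
    push_cast at h2 h4
    refine ⟨m, ⟨⟨?_, ?_⟩, hpar⟩, rfl⟩
    · rw [mul_div_assoc', div_le_iff₀ hd']
      linarith
    · rw [mul_div_assoc', lt_div_iff₀ hd']
      linarith
  · rintro ⟨m, ⟨⟨h2, h4⟩, hpar⟩, rfl⟩
    rw [mul_div_assoc', div_le_iff₀ hd'] at h2
    rw [mul_div_assoc', lt_div_iff₀ hd'] at h4
    refine ⟨⟨⟨?_, ?_⟩, hpar⟩, dvd_mul_right d m⟩
    · push_cast
      linarith
    · push_cast
      linarith

/-- Hence `|𝒜^{(−)^r}_d(X)| = #{m ∈ [2X/d, 4X/d) : Ω(dm) ≡ r + 1 (mod 2)}`.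
[cite: Greaves2001, §4.5.1 p. 123] -/
theorem card_filter_dvd_selbergSet {d : ℕ} (hd : 0 < d) (r : ℕ) (X : ℝ) :
    #((selbergSet r X).filter (d ∣ ·)) =
      #((Ico ⌈2 * (X / d)⌉₊ ⌈4 * (X / d)⌉₊).filter fun m => Ω (d * m) % 2 = (r + 1) % 2) := by
  rw [filter_dvd_selbergSet_eq_image hd, card_image_of_injective _ (mul_right_injective₀ hd.ne')]

/-- The parity classes of `Ω` are picked out by Liouville's function: for a finite set `I` of
positive integers and `d ≠ 0`,
`#{m ∈ I : Ω(dm) ≡ r + 1 (mod 2)} = ½ #I + ½ (−1)^{r+1+Ω(d)} ∑_{m ∈ I} λ(m)`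
("`½(1 ± λ(n))`", `Ω(dm) = Ω(d) + Ω(m)`). [cite: Greaves2001, §4.5.1 p. 123] -/
theorem card_filter_parity_eq {I : Finset ℕ} (hI : ∀ m ∈ I, m ≠ 0) {d : ℕ} (hd : d ≠ 0) (r : ℕ) :
    ((#(I.filter fun m => Ω (d * m) % 2 = (r + 1) % 2) : ℕ) : ℝ) =
      (#I : ℝ) / 2 + (-1 : ℝ) ^ (r + 1 + Ω d) / 2 * ∑ m ∈ I, (liouville m : ℝ) := by
  have key : ∀ m ∈ I, (if Ω (d * m) % 2 = (r + 1) % 2 then (1 : ℝ) else 0) =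
      1 / 2 + (-1 : ℝ) ^ (r + 1 + Ω d) / 2 * (liouville m : ℝ) := by
    intro m hm
    have hm0 := hI m hm
    rw [cardFactors_mul hd hm0, liouville_apply hm0]
    push_cast
    rcases Nat.even_or_odd (r + 1 + Ω d + Ω m) with he | ho
    · have h1 : (-1 : ℝ) ^ (r + 1 + Ω d) * (-1) ^ Ω m = 1 := by
        rw [← pow_add, he.neg_one_pow]
      have h2 : (Ω d + Ω m) % 2 = (r + 1) % 2 := by
        obtain ⟨k, hk⟩ := he
        omega
      rw [if_pos h2]
      linear_combination (-(1 / 2 : ℝ)) * h1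
    · have h1 : (-1 : ℝ) ^ (r + 1 + Ω d) * (-1) ^ Ω m = -1 := by
        rw [← pow_add, ho.neg_one_pow]
      have h2 : ¬ (Ω d + Ω m) % 2 = (r + 1) % 2 := by
        obtain ⟨k, hk⟩ := ho
        omega
      rw [if_neg h2]
      linear_combination (-(1 / 2 : ℝ)) * h1
  calc ((#(I.filter fun m => Ω (d * m) % 2 = (r + 1) % 2) : ℕ) : ℝ)
      = ∑ m ∈ I, (if Ω (d * m) % 2 = (r + 1) % 2 then (1 : ℝ) else 0) := by
        rw [Finset.sum_boole]
    _ = ∑ m ∈ I, (1 / 2 + (-1 : ℝ) ^ (r + 1 + Ω d) / 2 * (liouville m : ℝ)) := sum_congr rfl key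
    _ = (#I : ℝ) / 2 + (-1 : ℝ) ^ (r + 1 + Ω d) / 2 * ∑ m ∈ I, (liouville m : ℝ) := by
        rw [sum_add_distrib, sum_const, ← mul_sum, nsmul_eq_mul]
        ring

/-- `∑_{A ≤ m < B} f(m) = ∑_{m ≤ B−1} f(m) − ∑_{m ≤ A−1} f(m)` for `1 ≤ A ≤ B`. [folklore] -/
theorem sum_Ico_eq_sub {A B : ℕ} (hA : 1 ≤ A) (hAB : A ≤ B) (f : ℕ → ℝ) :
    ∑ m ∈ Ico A B, f m = ∑ m ∈ Ioc 0 (B - 1), f m - ∑ m ∈ Ioc 0 (A - 1), f m := by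
  have hIco : Ico A B = Ioc (A - 1) (B - 1) := by
    ext m
    simp only [mem_Ico, mem_Ioc]
    omega
  rw [hIco, eq_sub_iff_add_eq', Finset.sum_Ioc_consecutive _ (Nat.zero_le _) (by omega)]

/-! ### The Liouville input at arguments comparable to `Y` -/

/-- `e^{−c²/4} ≤ Y e^{−c√log Y}` for `Y ≥ 1` (`log Y − c√log Y ≥ −c²/4`). [folklore] -/
theorem exp_neg_sq_div_four_le {c Y : ℝ} (hY : 1 ≤ Y) :
    Real.exp (-(c ^ 2 / 4)) ≤ Y * Real.exp (-c * Real.sqrt (Real.log Y)) := by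
  have hY0 : 0 < Y := by linarith
  have hL : 0 ≤ Real.log Y := Real.log_nonneg hY
  set s := Real.sqrt (Real.log Y) with hs
  have hs2 : s ^ 2 = Real.log Y := Real.sq_sqrt hL
  conv_rhs => rw [← Real.exp_log hY0, ← Real.exp_add]
  refine Real.exp_le_exp.mpr ?_
  nlinarith [sq_nonneg (s - c / 2)]

/-- The prime number theorem for `λ` at the arguments needed: there are `c > 0`, `C ≥ 0` with
`|L(n)| ≤ C Y e^{−c√log Y}` whenever `1 ≤ Y ≤ n ≤ 4Y` (`L(n) = ∑_{m ≤ n} λ(m)`), from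
`|L(x)| ≤ C₀ x e^{−c√log x}` (`x ≥ 2`) and monotonicity of `e^{−c√log ·}`; `n = 1` by hand.
[cite: Greaves2001, §4.5.1 (1.2)] -/
theorem exists_abs_sum_liouville_le_of_le :
    ∃ c : ℝ, 0 < c ∧ ∃ C : ℝ, 0 ≤ C ∧ ∀ (n : ℕ) (Y : ℝ), 1 ≤ Y → Y ≤ n → (n : ℝ) ≤ 4 * Y →
      |∑ m ∈ Ioc 0 n, (liouville m : ℝ)| ≤ C * Y * Real.exp (-c * Real.sqrt (Real.log Y)) := by
  obtain ⟨c, hc, C₀, hC₀⟩ :=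
    Literature.NumberTheory.LFunctions.abs_sum_liouville_le_mul_exp_neg_sqrt_log
  refine ⟨c, hc, 4 * max C₀ 0 + 2 * Real.exp (c ^ 2 / 4), by positivity,
    fun n Y hY hYn hn4 => ?_⟩
  have hY0 : 0 < Y := by linarith
  set e : ℝ := Real.exp (-c * Real.sqrt (Real.log Y)) with he
  have he0 : 0 < e := Real.exp_pos _
  have hbase : Real.exp (-(c ^ 2 / 4)) ≤ Y * e := exp_neg_sq_div_four_le hY
  have hone : 1 ≤ Real.exp (c ^ 2 / 4) * (Y * e) := by
    have h := mul_le_mul_of_nonneg_left hbase (Real.exp_pos (c ^ 2 / 4)).le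
    rwa [← Real.exp_add, add_neg_cancel, Real.exp_zero] at h
  have hpart1 : 0 ≤ 4 * max C₀ 0 * (Y * e) := by positivity
  have hpart2 : 0 ≤ 2 * Real.exp (c ^ 2 / 4) * (Y * e) := by positivity
  rcases le_or_gt 2 (n : ℝ) with hn2 | hn2
  · have h := hC₀ n hn2
    rw [Nat.floor_natCast] at h
    have hlog : Real.log Y ≤ Real.log n := Real.log_le_log hY0 hYn
    have hexp : Real.exp (-c * Real.sqrt (Real.log n)) ≤ e := by
      refine Real.exp_le_exp.mpr ?_
      have := Real.sqrt_le_sqrt hlog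
      nlinarith
    calc |∑ m ∈ Ioc 0 n, (liouville m : ℝ)|
        ≤ C₀ * n * Real.exp (-c * Real.sqrt (Real.log n)) := h
      _ = C₀ * (n * Real.exp (-c * Real.sqrt (Real.log n))) := by ring
      _ ≤ max C₀ 0 * (n * Real.exp (-c * Real.sqrt (Real.log n))) := by
          gcongr
          exact le_max_left _ _
      _ ≤ max C₀ 0 * (4 * Y * e) := by
          gcongr
      _ = 4 * max C₀ 0 * (Y * e) := by ring
      _ ≤ 4 * max C₀ 0 * (Y * e) + 2 * Real.exp (c ^ 2 / 4) * (Y * e) := by linarith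
      _ = (4 * max C₀ 0 + 2 * Real.exp (c ^ 2 / 4)) * Y * e := by ring
  · calc |∑ m ∈ Ioc 0 n, (liouville m : ℝ)| ≤ n :=
          Literature.NumberTheory.LFunctions.LiouvilleSum.abs_sum_liouville_le n
      _ ≤ 2 * (Real.exp (c ^ 2 / 4) * (Y * e)) := by linarith
      _ = 2 * Real.exp (c ^ 2 / 4) * (Y * e) := by ring
      _ ≤ 4 * max C₀ 0 * (Y * e) + 2 * Real.exp (c ^ 2 / 4) * (Y * e) := by linarith
      _ = (4 * max C₀ 0 + 2 * Real.exp (c ^ 2 / 4)) * Y * e := by ring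

/-! ### Discharge of (4.5.1.3) -/

/-- **Discharge of `Greaves2001_selbergSet_remainder`** (Greaves (4.5.1.3)): there are `c > 0`
and `K` such that `|𝒜^{(−)^r}_d(X) − X/d| ≤ K (X/d) e^{−c√log(X/d)}` for all `r`, `X ≥ 1`,
`d ≥ 1`, i.e. Selberg's sets are `(c, K)`-regular (`IsSelbergRegular`). For `Y = X/d ≥ 1`:
`|𝒜_d| = ½ #{m : 2Y ≤ m < 4Y} ± ½ (L(⌈4Y⌉ − 1) − L(⌈2Y⌉ − 1))` with both `L`-arguments in
`[Y, 4Y]`, and the prime number theorem for `λ`; for `Y < 1` by counting.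
[cite: Greaves2001, §4.5.1 (1.2)–(1.3)] -/
theorem Greaves2001_selbergSet_remainder_holds : Greaves2001_selbergSet_remainder := by
  obtain ⟨c, hc, C, hC0, hC⟩ := exists_abs_sum_liouville_le_of_le
  set K : ℝ := max (Real.exp (c ^ 2 / 4) / 2 + C) 7 with hK
  refine ⟨c, hc, K, fun r => ?_⟩
  intro X hX d hd
  have hd0 : 0 < d := hd
  have hd' : (0 : ℝ) < d := by exact_mod_cast hd0
  set Y : ℝ := X / d with hY
  have hY0 : 0 < Y := div_pos (by linarith) hd'
  set e : ℝ := Real.exp (-c * Real.sqrt (Real.log Y)) with he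
  have he0 : 0 < e := Real.exp_pos _
  -- the count as a count over `I = [⌈2Y⌉, ⌈4Y⌉)`
  set A : ℕ := ⌈2 * Y⌉₊ with hA
  set B : ℕ := ⌈4 * Y⌉₊ with hB
  set I : Finset ℕ := Ico A B with hI
  have hcount : #((selbergSet r X).filter (d ∣ ·)) =
      #(I.filter fun m => Ω (d * m) % 2 = (r + 1) % 2) := card_filter_dvd_selbergSet hd0 r X
  have hA1 : 2 * Y ≤ A := Nat.le_ceil _
  have hA2 : (A : ℝ) < 2 * Y + 1 := Nat.ceil_lt_add_one (by positivity)
  have hB1 : 4 * Y ≤ B := Nat.le_ceil _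
  have hB2 : (B : ℝ) < 4 * Y + 1 := Nat.ceil_lt_add_one (by positivity)
  have hAB : A ≤ B := Nat.ceil_mono (by linarith)
  have hIcard : (#I : ℝ) = B - A := by
    rw [hI, Nat.card_Ico, Nat.cast_sub hAB]
  have hcountI : #(I.filter fun m => Ω (d * m) % 2 = (r + 1) % 2) ≤ #I := card_filter_le _ _
  rcases le_or_gt 1 Y with hY1 | hY1
  · -- main case `Y ≥ 1`
    have hApos : 1 ≤ A := by
      have : (1 : ℝ) ≤ A := by linarith
      exact_mod_cast this
    have hBpos : 1 ≤ B := hApos.trans hAB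
    have hI0 : ∀ m ∈ I, m ≠ 0 := by
      intro m hm
      rw [hI, mem_Ico] at hm
      omega
    have hid := card_filter_parity_eq hI0 hd0.ne' r
    set S : ℝ := ∑ m ∈ I, (liouville m : ℝ) with hS
    have hSeq : S = ∑ m ∈ Ioc 0 (B - 1), (liouville m : ℝ) -
        ∑ m ∈ Ioc 0 (A - 1), (liouville m : ℝ) := sum_Ico_eq_sub hApos hAB _
    -- the two `L`-values
    have hLB : |∑ m ∈ Ioc 0 (B - 1), (liouville m : ℝ)| ≤ C * Y * e := by
      refine hC (B - 1) Y hY1 ?_ ?_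
      · rw [Nat.cast_sub hBpos, Nat.cast_one]
        linarith
      · rw [Nat.cast_sub hBpos, Nat.cast_one]
        linarith
    have hLA : |∑ m ∈ Ioc 0 (A - 1), (liouville m : ℝ)| ≤ C * Y * e := by
      refine hC (A - 1) Y hY1 ?_ ?_
      · rw [Nat.cast_sub hApos, Nat.cast_one]
        linarith
      · rw [Nat.cast_sub hApos, Nat.cast_one]
        linarith
    have hSabs : |S| ≤ 2 * (C * Y * e) := by
      rw [hSeq]
      calc |∑ m ∈ Ioc 0 (B - 1), (liouville m : ℝ) - ∑ m ∈ Ioc 0 (A - 1), (liouville m : ℝ)|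
          ≤ |∑ m ∈ Ioc 0 (B - 1), (liouville m : ℝ)| + |∑ m ∈ Ioc 0 (A - 1), (liouville m : ℝ)| :=
            abs_sub _ _
        _ ≤ C * Y * e + C * Y * e := add_le_add hLB hLA
        _ = 2 * (C * Y * e) := by ring
    have hεS : |(-1 : ℝ) ^ (r + 1 + Ω d) / 2 * S| ≤ C * Y * e := by
      rw [abs_mul, abs_div, abs_pow, abs_neg, abs_one, one_pow, abs_two]
      linarith
    -- the `O(1)` term
    have hmain : |(#I : ℝ) / 2 - Y| ≤ 1 / 2 := by
      rw [hIcard, abs_le]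
      constructor <;> linarith
    have hbase : Real.exp (-(c ^ 2 / 4)) ≤ Y * e := exp_neg_sq_div_four_le hY1
    have hhalf : (1 : ℝ) / 2 ≤ Real.exp (c ^ 2 / 4) / 2 * (Y * e) := by
      have h := mul_le_mul_of_nonneg_left hbase (Real.exp_pos (c ^ 2 / 4)).le
      rw [← Real.exp_add, add_neg_cancel, Real.exp_zero] at h
      linarith
    -- assemble
    rw [hcount, hid]
    calc |(#I : ℝ) / 2 + (-1 : ℝ) ^ (r + 1 + Ω d) / 2 * S - Y|
        = |((#I : ℝ) / 2 - Y) + (-1 : ℝ) ^ (r + 1 + Ω d) / 2 * S| := by ring_nf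
      _ ≤ |(#I : ℝ) / 2 - Y| + |(-1 : ℝ) ^ (r + 1 + Ω d) / 2 * S| := abs_add_le _ _
      _ ≤ 1 / 2 + C * Y * e := add_le_add hmain hεS
      _ ≤ Real.exp (c ^ 2 / 4) / 2 * (Y * e) + C * Y * e := by linarith
      _ = (Real.exp (c ^ 2 / 4) / 2 + C) * Y * e := by ring
      _ ≤ K * Y * e := by
          have hYe : 0 ≤ Y * e := by positivity
          have : (Real.exp (c ^ 2 / 4) / 2 + C) ≤ K := le_max_left _ _
          nlinarith
  · -- `Y < 1`, i.e. `d > X`: counting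
    have he1 : e = 1 := by
      rw [he, Real.sqrt_eq_zero'.mpr (Real.log_neg hY0 hY1).le, mul_zero, Real.exp_zero]
    have hBA : (B : ℝ) - A ≤ 6 * Y := by
      rcases le_or_gt Y (1 / 4) with h14 | h14
      · have hB' : B ≤ 1 := Nat.ceil_le.mpr (by norm_num; linarith)
        have hA' : 1 ≤ A := Nat.one_le_iff_ne_zero.mpr (by
          rw [hA]
          exact (Nat.ceil_pos.mpr (by positivity)).ne')
        have : (B : ℝ) ≤ A := by exact_mod_cast hB'.trans hA'
        linarith
      · linarith
    have hcnt : (#(I.filter fun m => Ω (d * m) % 2 = (r + 1) % 2) : ℝ) ≤ 6 * Y := by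
      calc (#(I.filter fun m => Ω (d * m) % 2 = (r + 1) % 2) : ℝ) ≤ #I := by
            exact_mod_cast hcountI
        _ = B - A := hIcard
        _ ≤ 6 * Y := hBA
    rw [hcount, he1, mul_one]
    have hnn : (0 : ℝ) ≤ #(I.filter fun m => Ω (d * m) % 2 = (r + 1) % 2) := Nat.cast_nonneg _
    rw [abs_le]
    constructor
    · have : (7 : ℝ) ≤ K := le_max_right _ _
      nlinarith
    · have : (7 : ℝ) ≤ K := le_max_right _ _
      nlinarith

/-- **The sifting limit `β₁ = 2` cannot be lowered, unconditionally**: at the regularity level of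
Selberg's sets (now established, `Greaves2001_selbergSet_remainder_holds`), every valid lower
linear-sieve function satisfies `φ(s) ≤ 0` for `1 ≤ s < 2` (Greaves' Special Situation,
`siftingLimit_two_optimal_of_remainder`). [cite: Greaves2001, §4.5.1 "A Special Situation"] -/
theorem siftingLimit_two_optimal :
    ∃ c : ℝ, 0 < c ∧ ∃ K : ℝ, (∀ r : ℕ, IsSelbergRegular c K (selbergSet r)) ∧
      ∀ φ : ℝ → ℝ, IsLinearLowerSieveFun c K φ → ∀ s : ℝ, 1 ≤ s → s < 2 → φ s ≤ 0 :=
  siftingLimit_two_optimal_of_remainder Greaves2001_selbergSet_remainder_holds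

end Literature.Barriers.Parity
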